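import Literature.Probability.RandomPlanarGeometry.HullRestrictionSLEHolds
import HarnessLib

/-!
# Crux `HexConjecture` (stmt-CriticalPhenomena-0808), line `root-locality-replaces-loewner`,
stub `stub_avoidanceCocycle`, step (c): the Lawler–Schramm–Werner value of the avoidance
probability of a hull subdomain under the chordal SLE_{8/3} law

Landing target:
`Summits/CriticalPhenomena/SAWScalingLimit/Theorems/SAWDevelopingMapHexConjectureAvoidanceCocycleValue.lean`
(`--supports stmt-CriticalPhenomena-0808`).

Step (c) of the plan of `stub_avoidanceCocycle` identifies the limit `Φ_A'(0)^{5/8}` of the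
lattice restriction probabilities with the number `μ {range ⊆ closure D'}` appearing in the
conclusion `HexAvoidanceCocycle`, for ANY chordal SLE_{8/3} law `μ` of `(D; a, b)`, ANY chordal
uniformizing map `φ : (ℍ; 0, ∞) → (D; a, b)`, the pulled-back hull `A = closure (ℍ ∖ φ⁻¹ D')`
(`ConformalEquiv.pullbackHull`), its restriction map `Φ_A` and `d = Φ_A'(0)`:

  `μ (CurveClass.rangeSubset (closure D'.carrier)) = ENNReal.ofReal (d ^ (5/8))`.

Proof (`measure_rangeSubset_closure_eq_of_isSLELaw`): by uniqueness in law of chordal SLE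
(`IsSLECurve.map_eq_holds`) `μ` is the law of the SLE_{8/3} curve `Γ = φ̂(γ)` built on the GIVEN
uniformizer (`exists_isSLECurve_through_of_ae_tendsto`); on the almost sure event where the trace
`γ` is simple and transient, `{Γ ⊆ closure D'}` contains `{γ ∩ A = ∅}`
(`disjoint_range_pullbackHull_iff`) and is contained in `{γ(0, ∞) ⊆ closure (ℍ ∖ A)}`
(`forall_mem_closure_pullbackDomain`), whose probability is at most `P[γ ∩ A = ∅]` (touching
without entering is null, `measure_subset_closure_le_measure_avoid_of_hasSLETrace`); and
`P[γ ∩ A = ∅] = Φ_A'(0)^{5/8}` is [LSW] Thm. 6.1 in the half-plane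
(`sle_restriction_eightThirds_holds`).  This is the extraction, as a standalone statement, of
the step `hVEA` of the tree's proof of `IsSLELaw.hullRestriction_eightThirds_of_sle_restriction`.
-/

noncomputable section

open Set Filter Topology Metric MeasureTheory Complex
open UpperHalfPlane (upperHalfPlaneSet isOpen_upperHalfPlaneSet)
open scoped NNReal ENNReal
open Literature.Probability Literature.Probability.RandomPlanarGeometry

namespace Summit.CriticalPhenomena.SAWScalingLimit.Theorems.HexConjecture.RootLocality.Cocycle

/-- **The avoidance probability of a hull subdomain under chordal SLE_{8/3} is `Φ_A'(0)^{5/8}`.**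
For a chordal SLE_{8/3} law `μ` of a Dobrushin domain `D`, a hull subdomain `D'`, a chordal
uniformizing map `φ` of `D`, the restriction map `Φ` of the pulled-back hull `φ.pullbackHull D'`
and its derivative number `d = Φ'(0)`:
`μ {range ⊆ closure D'} = ENNReal.ofReal (d ^ (5/8))` ([LSW] Thm. 6.1 transposed; the event
`{Γ ⊆ closure D'}` and `{γ ∩ A = ∅}` differ by a null event).
[cite: LawlerSchrammWerner2003Restriction, Thm. 6.1 (p. 23) with Lemma 3.5 (p. 12)] -/
theorem measure_rangeSubset_closure_eq_of_isSLELaw {D D' : DobrushinDomain}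
    {μ : Measure (CurveClass ℂ)} (hμ : IsSLELaw ((8 : ℝ≥0) / 3) D μ)
    (hD' : D.IsHullSubdomain D') {φ : ConformalEquiv upperHalfPlaneSet D.carrier}
    (hφ : D.IsChordalUniformizing φ)
    {Φ : ConformalEquiv (upperHalfPlaneSet \ φ.pullbackHull D') upperHalfPlaneSet}
    (hΦ : IsRestrictionMap (φ.pullbackHull D') Φ) {d : ℝ}
    (hd : HasRestrictionDeriv (φ.pullbackHull D') Φ d) :
    μ (CurveClass.rangeSubset (closure D'.carrier)) = ENNReal.ofReal (d ^ ((5 : ℝ) / 8)) := by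
  classical
  have h61 : sle_restriction_eightThirds := sle_restriction_eightThirds_holds
  have hκt : HasSLETrace ((8 : ℝ≥0) / 3) := hasSLETrace_eightThirds
  have hsc : ∀ D : JordanDomain, D.isSimplyConnected := JordanDomain.isSimplyConnected_holds
  have hC : JordanDomain.exists_continuousOn_extension :=
    JordanDomain.exists_continuousOn_extension_holds
  have h₆ : RandomPlanarGeometry.ae_isSimpleTrace_sleTrace_of_le_four (κ := (8 : ℝ≥0) / 3) :=
    fun _ h4 ↦ ae_isSimpleTrace_sleTrace_of_hasSLETrace hκt h4
  have htr := tendsto_norm_sleTrace_atTop_eightThirds_of_hasSLETrace hκt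
  have hmeas : aemeasurable_sleTrace := aemeasurable_sleTrace_holds
  have hκ0 : (0 : ℝ≥0) < 8 / 3 := by positivity
  have hκ4 : (8 : ℝ≥0) / 3 ≤ 4 := by
    rw [div_le_iff₀ (by norm_num : (0 : ℝ≥0) < 3)]
    norm_num
  haveI hP : IsProbabilityMeasure Process.preWienerMeasure :=
    ⟨sle_restriction_eightThirds.measure_univ h61⟩
  have hext : JordanDomain.continuousOn_boundaryExtension :=
    JordanDomain.continuousOn_boundaryExtension_of_disc hC
  have h₈ : JordanDomain.mapsTo_boundaryExtension := JordanDomain.mapsTo_boundaryExtension_of_disc hC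
  have h₉ : CurveClass.measurableSet_simple (E := ℂ) := CurveClass.measurableSet_simple_holds
  -- the SLE curve through the GIVEN uniformizer, and `μ` is its law
  obtain ⟨Γ, hΓm, hΓae⟩ := exists_isSLECurve_through_of_ae_tendsto hκt htr hext (hmeas hκt) hφ
  have hΓ : IsSLECurve ((8 : ℝ≥0) / 3) D Γ := IsSLECurve.of_through hφ hΓm hΓae
  obtain ⟨Γ₀, hΓ₀, rfl⟩ := hμ
  rw [IsSLECurve.map_eq_holds hΓ₀ hΓ]
  have hΓsl : IsSLELaw ((8 : ℝ≥0) / 3) D (Process.preWienerMeasure.map Γ) := hΓ.isSLELaw_map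
  -- the hull
  have hA : IsStarHull (φ.pullbackHull D') := IsStarHull.pullbackHull hsc hφ hD'
  -- the good event
  have hgood : ∀ᵐ ω ∂Process.preWienerMeasure,
      Loewner.IsSimpleTrace (sleTrace ((8 : ℝ≥0) / 3) ω) ∧
      (∃ c : Curve ℂ, Γ ω = CurveClass.mk c ∧
        IsCompactifiedImage φ.boundaryExtension (sleTrace ((8 : ℝ≥0) / 3) ω) (D.pt 1) c) ∧
      (Γ ω ∈ CurveClass.simple ∧ (Γ ω).source = D.pt 0 ∧ (Γ ω).target = D.pt 1) := by
    filter_upwards [hΓae, h₆ hκ0 hκ4,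
      ae_of_ae_map hΓm (hΓsl.ae_simple h₆ h₉ hκ0 hκ4), ae_of_ae_map hΓm (hΓsl.ae_endpoints h₈)]
      with ω hω hs h1 h2
    exact ⟨hs, hω.2, h1.1, h2.1, h2.2.1⟩
  -- the event
  set V : Set (CurveClass ℂ) := CurveClass.rangeSubset (closure D'.carrier) with hVdef
  have hVm : MeasurableSet V := CurveClass.measurableSet_rangeSubset isClosed_closure
  -- on the good event: `{γ ∩ A = ∅} → Γ ∈ V`, and `Γ ∈ V → γ(0,∞) ⊆ closure (ℍ ∖ A)`
  have hkey : ∀ᵐ ω ∂Process.preWienerMeasure,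
      (Disjoint (range (sleTrace ((8 : ℝ≥0) / 3) ω)) (φ.pullbackHull D') → Γ ω ∈ V) ∧
      (Γ ω ∈ V → ∀ t, 0 < t →
        sleTrace ((8 : ℝ≥0) / 3) ω t ∈ closure (φ.pullbackDomain D')) := by
    filter_upwards [hgood] with ω ⟨hsimple, ⟨c, hΓω, hc⟩, hΓs, hΓsrc, hΓtgt⟩
    have h0 : sleTrace ((8 : ℝ≥0) / 3) ω 0 = 0 := sleTrace_zero _ ω
    rw [hΓω] at hΓs hΓsrc hΓtgt ⊢
    refine ⟨fun hr ↦ ?_, fun hV ↦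
      forall_mem_closure_pullbackDomain hD'.carrier_subset hsimple.2 hc hV⟩
    rw [disjoint_range_pullbackHull_iff hφ hD' h0 hsimple.2 hc] at hr
    exact subset_closure_of_subset_carrier_union hr
  -- `μ V = P[γ ∩ A = ∅]`
  have hT6 := measure_subset_closure_le_measure_avoid_of_hasSLETrace hφ hD' h61 hκt
  have hmapV : Process.preWienerMeasure.map Γ V = Process.preWienerMeasure (Γ ⁻¹' V) :=
    Measure.map_apply_of_aemeasurable hΓm hVm
  have hle1 : Process.preWienerMeasure (Γ ⁻¹' V) ≤ Process.preWienerMeasure {ω | ∀ t, 0 < t →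
      sleTrace ((8 : ℝ≥0) / 3) ω t ∈ closure (φ.pullbackDomain D')} :=
    measure_mono_ae (hkey.mono fun ω hω hV ↦ hω.2 hV)
  have hle2 : Process.preWienerMeasure {ω | Disjoint (range (sleTrace ((8 : ℝ≥0) / 3) ω))
      (φ.pullbackHull D')} ≤ Process.preWienerMeasure (Γ ⁻¹' V) :=
    measure_mono_ae (hkey.mono fun ω hω hE ↦ hω.1 hE)
  rw [hmapV, ← h61 hA hΦ hd]
  exact le_antisymm (hle1.trans hT6) hle2

/-- **Registered form `stub_avoidanceCocycle_value`** (crux item stmt-CriticalPhenomena-0808, line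
`root-locality-replaces-loewner`, stub `stub_avoidanceCocycle`, step (c)): the avoidance
probability of a hull subdomain under any chordal SLE_{8/3} law of `D` is `Φ_A'(0)^{5/8}` for the
pulled-back hull of any chordal uniformizing map (`measure_rangeSubset_closure_eq_of_isSLELaw`).
[cite: LawlerSchrammWerner2003Restriction, Thm. 6.1 (p. 23) with Lemma 3.5 (p. 12)] -/
theorem stub_avoidanceCocycle_value : ∀ (D D' : Literature.Probability.RandomPlanarGeometry.DobrushinDomain) (μ : MeasureTheory.Measure (Literature.Probability.RandomPlanarGeometry.CurveClass ℂ)) (φ : Literature.Probability.RandomPlanarGeometry.ConformalEquiv UpperHalfPlane.upperHalfPlaneSet D.carrier) (Φ : Literature.Probability.RandomPlanarGeometry.ConformalEquiv (UpperHalfPlane.upperHalfPlaneSet \ φ.pullbackHull D') UpperHalfPlane.upperHalfPlaneSet) (d : ℝ), Literature.Probability.RandomPlanarGeometry.IsSLELaw ((8 : NNReal) / 3) D μ → D.IsHullSubdomain D' → D.IsChordalUniformizing φ → Literature.Probability.RandomPlanarGeometry.IsRestrictionMap (φ.pullbackHull D') Φ → Literature.Probability.RandomPlanarGeometry.HasRestrictionDeriv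 (φ.pullbackHull D') Φ d → μ (Literature.Probability.RandomPlanarGeometry.CurveClass.rangeSubset (closure D'.carrier)) = ENNReal.ofReal (d ^ ((5 : ℝ) / 8)) :=
  fun _ _ _ _ _ _ hμ hD' hφ hΦ hd => measure_rangeSubset_closure_eq_of_isSLELaw hμ hD' hφ hΦ hd

end Summit.CriticalPhenomena.SAWScalingLimit.Theorems.HexConjecture.RootLocality.Cocycle

end
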